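import Mathlib
import Literature.AlgebraicGeometry.Resolution.LocalBlowup
import Literature.AlgebraicGeometry.Resolution.TranscendenceDefect
import Literature.RingTheory.KrullDimension.AffineDimension
import Literature.RingTheory.KrullDimension.LocalizationDimension
import HarnessLib

/-!
# PORT (T-slice module map §16 (v), part 1) of res-B-lens-5's companion `Cruxes/DescentPerfectToAll/Lens5_PRankTwoLattice.lean` rev 1 (cdb420791787),
# §H Laurent-monomial helpers + §L (3-L-a) monomial weights, (3-L-b) the exponent lattice `L = pℤ³ + ℤeA + ℤeB`, the read-outs and `exists_indep_kernel_pair`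

Author res-B-lens-5 (g10); ported verbatim by res-B-lead-1 (kits UR9/R1A = ✓ ports (i)/(ii) by res-B-cdiv-w1/w4; `RankOneArchimedean.*` ↦
`Lens5RankOneArchimedean.*`).  OURS; nothing here proves resolution in characteristic `p`.
-/

noncomputable section

set_option linter.dupNamespace false -- mandated namespace of this single-conjunct summit

open IsLocalRing
open Literature.AlgebraicGeometry.Resolution

namespace Summit.ResolutionOfSingularities.ResolutionOfSingularities.Theorems.RadicialJung.CleanModels.Lens5.PRankTwoAssembly

set_option linter.unusedVariables false

/-! ### (rev 6) Laurent-monomial algebra in a commutative group with zero (used in `K` and in the value group) -/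

/-- `a ^ (Σ f) = ∏ a ^ f` for integer exponents, `a ≠ 0`. [folklore] -/
theorem zpow_finsum {G₀ : Type} [CommGroupWithZero G₀] {ι : Type} [DecidableEq ι] {a : G₀} (ha : a ≠ 0)
    (s : Finset ι) (f : ι → ℤ) : a ^ (∑ i ∈ s, f i) = ∏ i ∈ s, a ^ f i := by
  induction s using Finset.induction_on with
  | empty => simp
  | insert i s hi ih => rw [Finset.sum_insert hi, Finset.prod_insert hi, zpow_add₀ ha, ih]

/-- `∏ zᵢ^{Cᵢ + Dᵢ} = ∏ zᵢ^{Cᵢ} · ∏ zᵢ^{Dᵢ}`. [folklore] -/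
theorem prod_zpow_add {G₀ : Type} [CommGroupWithZero G₀] {ι : Type} [Fintype ι] {z : ι → G₀} (hz0 : ∀ i, z i ≠ 0)
    (C D : ι → ℤ) : ∏ i, z i ^ (C i + D i) = (∏ i, z i ^ C i) * ∏ i, z i ^ D i := by
  rw [← Finset.prod_mul_distrib]
  exact Finset.prod_congr rfl fun i _ => zpow_add₀ (hz0 i) _ _

/-- `∏ zᵢ^{n·Cᵢ} = (∏ zᵢ^{Cᵢ})^n`. [folklore] -/
theorem prod_zpow_smul {G₀ : Type} [CommGroupWithZero G₀] {ι : Type} [Fintype ι] (z : ι → G₀)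
    (n : ℤ) (C : ι → ℤ) : ∏ i, z i ^ (n * C i) = (∏ i, z i ^ C i) ^ n := by
  rw [← Finset.prod_zpow]
  exact Finset.prod_congr rfl fun i _ => by rw [mul_comm, zpow_mul]

/-- `∏ᵢ zᵢ^{Σⱼ dⱼ cⱼᵢ} = ∏ⱼ (∏ᵢ zᵢ^{cⱼᵢ})^{dⱼ}`. [folklore] -/
theorem prod_zpow_lincomb {G₀ : Type} [CommGroupWithZero G₀] {ι κ : Type} [Fintype ι] [Fintype κ] [DecidableEq κ]
    {z : ι → G₀} (hz0 : ∀ i, z i ≠ 0) (d : κ → ℤ) (c : κ → ι → ℤ) :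
    ∏ i, z i ^ (∑ j, d j * c j i) = ∏ j, (∏ i, z i ^ c j i) ^ d j := by
  calc ∏ i, z i ^ (∑ j, d j * c j i) = ∏ i, ∏ j, (z i ^ c j i) ^ d j := by
        refine Finset.prod_congr rfl fun i _ => ?_
        rw [zpow_finsum (hz0 i)]
        exact Finset.prod_congr rfl fun j _ => by rw [mul_comm, zpow_mul]
    _ = ∏ j, ∏ i, (z i ^ c j i) ^ d j := Finset.prod_comm
    _ = ∏ j, (∏ i, z i ^ c j i) ^ d j := Finset.prod_congr rfl fun j _ => Finset.prod_zpow _ _ _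

/-- `t ↦ t ^ p` is injective on a linearly ordered commutative group with zero (`p ≠ 0`) (census/PunchlineBits copy). [folklore] -/
theorem pow_left_injective_of_ne_zero {Γ₀ : Type} [LinearOrderedCommGroupWithZero Γ₀] {p : ℕ} (hp : p ≠ 0)
    {a b : Γ₀} (h : a ^ p = b ^ p) : a = b := by
  rcases lt_trichotomy a b with hab | hab | hab
  · exact absurd h (ne_of_lt (pow_lt_pow_left₀ hab zero_le hp))
  · exact hab
  · exact absurd h.symm (ne_of_lt (pow_lt_pow_left₀ hab zero_le hp))


/-! ## §L THE PROOF OF PORT 3-L -/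

/-! ### (rev 7) PORT 3-L split: (a) monomial values as weights, (b) the exponent lattice `L = pℤ³ + ℤeA + ℤeB` (membership, normal
form, a `Fin 3`-basis), (c) two ABSTRACT lattice-chart lemmas (archimedean / two-level — pure ordered-group statements over the ✓ kit),
(d) the two-level data of a valuation ring with a proper coarsening, and the glue. -/

/-- **(3-L-a) values of monomials are products of the weights `v(wᵢ)`** (`v(zᵢ) = v(wᵢ)^p`, `x^p = α z^{eA}`, `y^p = β z^{eB}`,
`v α = v β = 1`): `v(z^C x^a y^b) = ∏ v(wᵢ)^{p Cᵢ + a eAᵢ + b eBᵢ}`.  PROVED. [folklore] -/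
theorem valuation_monomial_eq_prod_weights (p : ℕ) [Fact p.Prime] {K : Type} [Field K] (O : ValuationSubring K) {x y : K}
    (hx : x ≠ 0) (hy : y ≠ 0) (z : Fin 3 → K) (hz0 : ∀ i, z i ≠ 0) (w : Fin 3 → K) (hw0 : ∀ i, w i ≠ 0)
    (hwv : ∀ i, O.valuation (z i) = O.valuation (w i ^ p))
    (α β : K) (hα : O.valuation α = 1) (hβ : O.valuation β = 1) (eA eB : Fin 3 → ℤ)
    (hxA : x ^ p = α * ∏ i, z i ^ eA i) (hyB : y ^ p = β * ∏ i, z i ^ eB i) (C : Fin 3 → ℤ) (a b : ℕ) :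
    O.valuation ((∏ i, z i ^ C i) * (x ^ a * y ^ b)) =
      ∏ i, O.valuation (w i) ^ ((p : ℤ) * C i + (a : ℤ) * eA i + (b : ℤ) * eB i) := by
  classical
  have hp := (Fact.out : p.Prime)
  set V := O.valuation with hV
  have hVx : V x ≠ 0 := (Valuation.ne_zero_iff V).mpr hx
  have hVy : V y ≠ 0 := (Valuation.ne_zero_iff V).mpr hy
  have hVz : ∀ i, V (z i) ≠ 0 := fun i => (Valuation.ne_zero_iff V).mpr (hz0 i)
  have hVw : ∀ i, V (w i) ≠ 0 := fun i => (Valuation.ne_zero_iff V).mpr (hw0 i)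
  have hZW : ∀ i, V (z i) = V (w i) ^ p := fun i => by rw [hwv i, map_pow]
  -- `V x = ∏ V wᵢ ^ eAᵢ`, `V y = ∏ V wᵢ ^ eBᵢ` (unique `p`-th roots)
  have hroot : ∀ (t : K) (γ : K) (hγ : V γ = 1) (e : Fin 3 → ℤ), t ^ p = γ * ∏ i, z i ^ e i →
      V t = ∏ i, V (w i) ^ e i := by
    intro t γ hγ e ht
    apply pow_left_injective_of_ne_zero hp.ne_zero
    have h := congrArg V ht
    rw [map_pow, map_mul, hγ, one_mul, map_prod] at h
    rw [h, ← zpow_natCast (∏ i, V (w i) ^ e i), ← prod_zpow_smul]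
    refine Finset.prod_congr rfl fun i _ => ?_
    rw [map_zpow₀, hZW i, ← zpow_natCast, ← zpow_mul]
  have hX := hroot x α hα eA hxA
  have hY := hroot y β hβ eB hyB
  rw [map_mul, map_mul, map_pow, map_pow, map_prod, hX, hY, prod_zpow_add hVw, prod_zpow_add hVw, prod_zpow_smul,
    prod_zpow_smul, prod_zpow_smul]
  have hC : ∏ i, V (z i ^ C i) = (∏ i, V (w i) ^ C i) ^ (p : ℤ) := by
    rw [← prod_zpow_smul]
    refine Finset.prod_congr rfl fun i _ => ?_
    rw [map_zpow₀, hZW i, ← zpow_natCast, ← zpow_mul]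
  rw [hC, zpow_natCast, zpow_natCast, zpow_natCast, mul_assoc]

/-- **(3-L-b) membership in the exponent lattice** `L = pℤ³ + ℤ eA + ℤ eB`. PROVED. [folklore] -/
theorem mem_toricLattice_iff (p : ℤ) (eA eB ℓ : Fin 3 → ℤ) :
    ℓ ∈ Submodule.span ℤ (Set.range fun i : Fin 3 => (Pi.single i p : Fin 3 → ℤ)) ⊔ Submodule.span ℤ {eA, eB} ↔
      ∃ (C : Fin 3 → ℤ) (a b : ℤ), ∀ i, ℓ i = p * C i + a * eA i + b * eB i := by
  classical
  have hsum : ∀ (C : Fin 3 → ℤ) (i : Fin 3), (∑ j, C j • (Pi.single j p : Fin 3 → ℤ)) i = p * C i := by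
    intro C i
    rw [Finset.sum_apply, Finset.sum_eq_single i]
    · rw [Pi.smul_apply, Pi.single_eq_same, smul_eq_mul, mul_comm]
    · intro j _ hj
      rw [Pi.smul_apply, Pi.single_eq_of_ne' hj, smul_zero]
    · intro h
      exact absurd (Finset.mem_univ i) h
  constructor
  · intro h
    obtain ⟨u, hu, v, hv, huv⟩ := Submodule.mem_sup.mp h
    obtain ⟨C, hC⟩ := (Submodule.mem_span_range_iff_exists_fun ℤ).mp hu
    obtain ⟨a, b, hab⟩ := Submodule.mem_span_pair.mp hv
    refine ⟨C, a, b, fun i => ?_⟩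
    rw [← huv, ← hC, ← hab, Pi.add_apply, hsum, Pi.add_apply, Pi.smul_apply, Pi.smul_apply, smul_eq_mul, smul_eq_mul]
    ring
  · rintro ⟨C, a, b, h⟩
    have hℓ : ℓ = (∑ j, C j • (Pi.single j p : Fin 3 → ℤ)) + (a • eA + b • eB) := by
      funext i
      rw [Pi.add_apply, hsum, Pi.add_apply, Pi.smul_apply, Pi.smul_apply, smul_eq_mul, smul_eq_mul, h i]
      ring
    rw [hℓ]
    exact Submodule.add_mem_sup
      (Submodule.sum_mem _ fun j _ => Submodule.smul_mem _ _ (Submodule.subset_span ⟨j, rfl⟩))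
      (Submodule.mem_span_pair.mpr ⟨a, b, rfl⟩)

/-- **(3-L-b) normal form**: every `p·C + a·eA + b·eB` can be rewritten with `0 ≤ a, b < p`. PROVED. [folklore] -/
theorem toricLattice_normalForm (p : ℕ) (hp : 0 < p) (eA eB : Fin 3 → ℤ) (C : Fin 3 → ℤ) (a b : ℤ) :
    ∃ (C' : Fin 3 → ℤ) (a' b' : ℕ), a' < p ∧ b' < p ∧
      ∀ i, (p : ℤ) * C i + a * eA i + b * eB i = (p : ℤ) * C' i + (a' : ℤ) * eA i + (b' : ℤ) * eB i := by
  have hp0 : (p : ℤ) ≠ 0 := by exact_mod_cast hp.ne'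
  have hpp : (0 : ℤ) < p := by exact_mod_cast hp
  obtain ⟨a₀, ha₀⟩ : ∃ a₀ : ℕ, (a₀ : ℤ) = a % p := ⟨(a % p).toNat, Int.toNat_of_nonneg (Int.emod_nonneg a hp0)⟩
  obtain ⟨b₀, hb₀⟩ : ∃ b₀ : ℕ, (b₀ : ℤ) = b % p := ⟨(b % p).toNat, Int.toNat_of_nonneg (Int.emod_nonneg b hp0)⟩
  have ha : a = p * (a / p) + a₀ := by rw [ha₀]; exact (Int.mul_ediv_add_emod a p).symm
  have hb : b = p * (b / p) + b₀ := by rw [hb₀]; exact (Int.mul_ediv_add_emod b p).symm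
  refine ⟨fun i => C i + a / p * eA i + b / p * eB i, a₀, b₀, ?_, ?_, fun i => ?_⟩
  · have h := Int.emod_lt_of_pos a hpp
    rw [← ha₀] at h
    exact_mod_cast h
  · have h := Int.emod_lt_of_pos b hpp
    rw [← hb₀] at h
    exact_mod_cast h
  · linear_combination (eA i) * ha + (eB i) * hb

/-- **(3-L-b) the exponent lattice is free of rank 3** (`pℤ³ ≤ L ≤ ℤ³`). PROVED. [folklore] -/
theorem toricLattice_basis (p : ℕ) (hp : 0 < p) (eA eB : Fin 3 → ℤ) :
    Nonempty (Module.Basis (Fin 3) ℤ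
      ↥(Submodule.span ℤ (Set.range fun i : Fin 3 => (Pi.single i (p : ℤ) : Fin 3 → ℤ)) ⊔ Submodule.span ℤ {eA, eB})) := by
  classical
  set L := Submodule.span ℤ (Set.range fun i : Fin 3 => (Pi.single i (p : ℤ) : Fin 3 → ℤ)) ⊔ Submodule.span ℤ {eA, eB} with hL
  obtain ⟨n, ⟨b'⟩⟩ := Submodule.nonempty_basis_of_pid (Pi.basisFun ℤ (Fin 3)) L
  have hp0 : (p : ℤ) ≠ 0 := by exact_mod_cast hp.ne'
  -- three independent vectors `p·δᵢ ∈ L`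
  have hmem : ∀ i : Fin 3, (Pi.single i (p : ℤ) : Fin 3 → ℤ) ∈ L := fun i =>
    Submodule.mem_sup_left (Submodule.subset_span ⟨i, rfl⟩)
  have hli : LinearIndependent ℤ (fun i : Fin 3 => (⟨Pi.single i (p : ℤ), hmem i⟩ : L)) := by
    apply LinearIndependent.of_comp L.subtype
    rw [Fintype.linearIndependent_iff]
    intro g hg i
    have h := congrArg (fun v : Fin 3 → ℤ => v i) hg
    simp only [Function.comp_apply, Submodule.coe_subtype, Finset.sum_apply, Pi.smul_apply, Pi.zero_apply, smul_eq_mul,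
      Pi.single_apply, mul_ite, mul_zero, Finset.sum_ite_eq, Finset.mem_univ, if_true] at h
    exact (mul_eq_zero.mp h).resolve_right hp0
  have h3 : Module.finrank ℤ L = 3 := by
    refine le_antisymm ?_ ?_
    · exact (Submodule.finrank_le L).trans (Module.finrank_fin_fun ℤ).le
    · have h := hli.fintype_card_le_finrank
      rwa [Fintype.card_fin] at h
  have hn : n = 3 := by
    have h := Module.finrank_eq_card_basis b'
    rw [Fintype.card_fin] at h
    omega
  exact ⟨b'.reindex (finCongr hn)⟩

/-- **Read-out, rank-one image (`ρ = 1`)**: a basis `e` with one positive vector `e i₀` carrying the whole weight. [folklore] -/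
theorem readout_rank_one {L : Type} [AddCommGroup L] {W : Type} [AddCommGroup W] [LinearOrder W] [IsOrderedAddMonoid W]
    (φ : L →+ W) (F : Finset L) (e : Module.Basis (Fin 3) ℤ L) (i₀ : Fin 3) (hpos : 0 < φ (e i₀))
    (hker : ∀ i, i ≠ i₀ → φ (e i) = 0) (hposc : ∀ f ∈ F, 0 < e.repr f i₀) (hzero : ∀ f : L, φ f = 0 → e.repr f i₀ = 0) :
    ∃ (ρ : ℕ), (ρ = 1 ∨ ρ = 2) ∧ ∃ M : Fin 3 → L,
      (∀ j : Fin 3, (j : ℕ) < ρ → 0 < φ (M j)) ∧ (∀ j : Fin 3, ρ ≤ (j : ℕ) → φ (M j) = 0) ∧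
      (∀ f ∈ F, ∃ d : Fin 3 → ℤ, f = ∑ j, d j • M j ∧ (∀ j : Fin 3, (j : ℕ) < ρ → 0 ≤ d j) ∧
        ∃ j : Fin 3, (j : ℕ) < ρ ∧ 0 < d j) ∧
      (∀ f : L, φ f = 0 → ∃ d : Fin 3 → ℤ, f = ∑ j, d j • M j ∧ ∀ j : Fin 3, (j : ℕ) < ρ → d j = 0) := by
  classical
  -- a permutation `σ` of `Fin 3` with `σ 0 = i₀`; the chart is `e ∘ σ`
  let σ : Equiv.Perm (Fin 3) := Equiv.swap 0 i₀
  have hσ0 : σ 0 = i₀ := Equiv.swap_apply_left 0 i₀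
  have hσj : ∀ j : Fin 3, j ≠ 0 → σ j ≠ i₀ := fun j hj h => hj (σ.injective (h.trans hσ0.symm))
  have hsum : ∀ f : L, f = ∑ j, e.repr f (σ j) • e (σ j) := by
    intro f
    rw [Equiv.sum_comp σ (fun i => e.repr f i • e i)]
    exact (e.sum_repr f).symm
  have hj0 : ∀ j : Fin 3, (j : ℕ) < 1 → j = 0 := fun j hj => Fin.ext (by omega)
  have hj1 : ∀ j : Fin 3, 1 ≤ (j : ℕ) → j ≠ 0 := fun j hj h => by subst h; simp at hj
  refine ⟨1, Or.inl rfl, fun j => e (σ j), ?_, ?_, ?_, ?_⟩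
  · intro j hj
    obtain rfl := hj0 j hj
    show 0 < φ (e (σ 0))
    rw [hσ0]
    exact hpos
  · intro j hj
    exact hker _ (hσj j (hj1 j hj))
  · intro f hf
    refine ⟨fun j => e.repr f (σ j), hsum f, fun j hj => ?_, ⟨0, Nat.zero_lt_one, ?_⟩⟩
    · obtain rfl := hj0 j hj
      show 0 ≤ e.repr f (σ 0)
      rw [hσ0]
      exact (hposc f hf).le
    · show 0 < e.repr f (σ 0)
      rw [hσ0]
      exact hposc f hf
  · intro f hf
    refine ⟨fun j => e.repr f (σ j), hsum f, fun j hj => ?_⟩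
    obtain rfl := hj0 j hj
    show e.repr f (σ 0) = 0
    rw [hσ0]
    exact hzero f hf

/-- **Read-out, positive plane (`ρ = 2`)**: the unimodular refinement `(m₁, m₂)` of the positive plane plus the kernel vector `e 2`.
[folklore] -/
theorem readout_rank_two {L : Type} [AddCommGroup L] {W : Type} [AddCommGroup W] [LinearOrder W] [IsOrderedAddMonoid W]
    (φ : L →+ W) (F : Finset L) (e : Module.Basis (Fin 3) ℤ L) (m₁ m₂ : L) (a b' c d : ℤ)
    (he2 : φ (e 2) = 0) (hm₁ : 0 < φ m₁) (hm₂ : 0 < φ m₂)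
    (hkc : ∀ f : L, φ f = 0 → e.repr f 0 = 0 ∧ e.repr f 1 = 0)
    (hFc : ∀ f ∈ F, f = (e.repr f 0 * a + e.repr f 1 * c) • m₁ + (e.repr f 0 * b' + e.repr f 1 * d) • m₂ + e.repr f 2 • e 2 ∧
      0 ≤ e.repr f 0 * a + e.repr f 1 * c ∧ 0 ≤ e.repr f 0 * b' + e.repr f 1 * d ∧
      (0 < e.repr f 0 * a + e.repr f 1 * c ∨ 0 < e.repr f 0 * b' + e.repr f 1 * d)) :
    ∃ (ρ : ℕ), (ρ = 1 ∨ ρ = 2) ∧ ∃ M : Fin 3 → L,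
      (∀ j : Fin 3, (j : ℕ) < ρ → 0 < φ (M j)) ∧ (∀ j : Fin 3, ρ ≤ (j : ℕ) → φ (M j) = 0) ∧
      (∀ f ∈ F, ∃ d : Fin 3 → ℤ, f = ∑ j, d j • M j ∧ (∀ j : Fin 3, (j : ℕ) < ρ → 0 ≤ d j) ∧
        ∃ j : Fin 3, (j : ℕ) < ρ ∧ 0 < d j) ∧
      (∀ f : L, φ f = 0 → ∃ d : Fin 3 → ℤ, f = ∑ j, d j • M j ∧ ∀ j : Fin 3, (j : ℕ) < ρ → d j = 0) := by
  classical
  refine ⟨2, Or.inr rfl, ![m₁, m₂, e 2], ?_, ?_, ?_, ?_⟩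
  · intro j hj
    fin_cases j
    · exact hm₁
    · exact hm₂
    · simp at hj
  · intro j hj
    fin_cases j
    · simp at hj
    · simp at hj
    · exact he2
  · intro f hf
    obtain ⟨hf', h0, h1, hpos⟩ := hFc f hf
    refine ⟨![e.repr f 0 * a + e.repr f 1 * c, e.repr f 0 * b' + e.repr f 1 * d, e.repr f 2], ?_, ?_, ?_⟩
    · rw [Fin.sum_univ_three]
      exact hf'
    · intro j hj
      fin_cases j
      · exact h0
      · exact h1
      · simp at hj
    · rcases hpos with h | h
      · exact ⟨0, by decide, h⟩
      · exact ⟨1, by decide, h⟩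
  · intro f hf
    obtain ⟨h0, h1⟩ := hkc f hf
    refine ⟨![0, 0, e.repr f 2], ?_, ?_⟩
    · rw [Fin.sum_univ_three]
      show f = (0 : ℤ) • m₁ + (0 : ℤ) • m₂ + e.repr f 2 • e 2
      rw [zero_smul, zero_smul, zero_add, zero_add]
      conv_lhs => rw [← e.sum_repr f, Fin.sum_univ_three, h0, h1, zero_smul, zero_smul, zero_add, zero_add]
    · intro j hj
      fin_cases j
      · rfl
      · rfl
      · simp at hj

/-- Two independent kernel vectors of `φ` from pairwise `ℤ`-dependence of the weights `φ (b i)` (`W` torsion-free). [folklore] -/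
theorem exists_indep_kernel_pair {L : Type} [AddCommGroup L] (b : Module.Basis (Fin 3) ℤ L)
    {W : Type} [AddCommGroup W] [LinearOrder W] [IsOrderedAddMonoid W] (φ : L →+ W)
    (hdep : ∀ i j : Fin 3, ∃ s t : ℤ, (s ≠ 0 ∨ t ≠ 0) ∧ s • φ (b i) + t • φ (b j) = 0) :
    ∃ x y : L, φ x = 0 ∧ φ y = 0 ∧ ∀ s t : ℤ, s • x + t • y = 0 → s = 0 ∧ t = 0 := by
  classical
  have hφ2 : ∀ (s t : ℤ) (i j : Fin 3), φ (s • b i + t • b j) = s • φ (b i) + t • φ (b j) := by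
    intro s t i j
    rw [map_add, map_zsmul, map_zsmul]
  -- torsion: `s • w = 0`, `s ≠ 0` ⟹ `w = 0`
  have htor : ∀ (s : ℤ) (w : W), s ≠ 0 → s • w = 0 → w = 0 := by
    intro s w hs h
    rcases lt_trichotomy w 0 with hlt | heq | hgt
    · rcases lt_or_gt_of_ne hs with hs' | hs'
      · have h' := zsmul_pos (neg_pos.mpr hlt) (neg_pos.mpr hs')
        rw [smul_neg, neg_zsmul, neg_neg] at h'
        exact absurd h (ne_of_gt h')
      · have h' := zsmul_pos (neg_pos.mpr hlt) hs'
        rw [smul_neg] at h'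
        exact absurd h (ne_of_lt (neg_pos.mp h'))
    · exact heq
    · rcases lt_or_gt_of_ne hs with hs' | hs'
      · have h' := zsmul_pos hgt (neg_pos.mpr hs')
        rw [neg_zsmul] at h'
        exact absurd h (ne_of_lt (neg_pos.mp h'))
      · exact absurd h (ne_of_gt (zsmul_pos hgt hs'))
  by_cases h0 : φ (b 0) = 0
  · obtain ⟨s, t, hst, hrel⟩ := hdep 1 2
    refine ⟨b 0, s • b 1 + t • b 2, h0, by rw [hφ2]; exact hrel, fun u v huv => ?_⟩
    have hc0 := congrArg (fun z => b.repr z 0) huv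
    have hc1 := congrArg (fun z => b.repr z 1) huv
    have hc2 := congrArg (fun z => b.repr z 2) huv
    simp only [smul_add, ← mul_smul, map_add, map_zsmul, Module.Basis.repr_self, Finsupp.coe_add, Finsupp.coe_smul,
      Pi.add_apply, Pi.smul_apply, Finsupp.single_apply, smul_eq_mul, map_zero, Finsupp.coe_zero, Pi.zero_apply] at hc0 hc1 hc2
    simp only [show ((2 : Fin 3) = 0) ↔ False from by decide, show ((2 : Fin 3) = 1) ↔ False from by decide,
      show ((0 : Fin 3) = 2) ↔ False from by decide, show ((1 : Fin 3) = 2) ↔ False from by decide,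
      show ((0 : Fin 3) = 1) ↔ False from by decide, show ((1 : Fin 3) = 0) ↔ False from by decide,
      if_false, if_true, mul_one, mul_zero, add_zero, zero_add] at hc0 hc1 hc2
    refine ⟨hc0, ?_⟩
    rcases hst with hs | ht
    · exact (mul_eq_zero.mp hc1).resolve_right hs
    · exact (mul_eq_zero.mp hc2).resolve_right ht
  · obtain ⟨s₁, t₁, hst₁, hrel₁⟩ := hdep 0 1
    obtain ⟨s₂, t₂, hst₂, hrel₂⟩ := hdep 0 2
    have ht₁ : t₁ ≠ 0 := by
      rintro rfl
      rw [zero_smul, add_zero] at hrel₁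
      have hs₁ : s₁ ≠ 0 := hst₁.resolve_right (fun h => h rfl)
      exact h0 (htor s₁ _ hs₁ hrel₁)
    have ht₂ : t₂ ≠ 0 := by
      rintro rfl
      rw [zero_smul, add_zero] at hrel₂
      have hs₂ : s₂ ≠ 0 := hst₂.resolve_right (fun h => h rfl)
      exact h0 (htor s₂ _ hs₂ hrel₂)
    refine ⟨s₁ • b 0 + t₁ • b 1, s₂ • b 0 + t₂ • b 2, by rw [hφ2]; exact hrel₁, by rw [hφ2]; exact hrel₂,
      fun u v huv => ?_⟩
    have hc1 := congrArg (fun z => b.repr z 1) huv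
    have hc2 := congrArg (fun z => b.repr z 2) huv
    simp only [smul_add, ← mul_smul, map_add, map_zsmul, Module.Basis.repr_self, Finsupp.coe_add, Finsupp.coe_smul,
      Pi.add_apply, Pi.smul_apply, Finsupp.single_apply, smul_eq_mul, map_zero, Finsupp.coe_zero, Pi.zero_apply] at hc1 hc2
    simp only [show ((2 : Fin 3) = 1) ↔ False from by decide,
      show ((0 : Fin 3) = 2) ↔ False from by decide, show ((1 : Fin 3) = 2) ↔ False from by decide,
      show ((0 : Fin 3) = 1) ↔ False from by decide,
      if_false, if_true, mul_one, mul_zero, add_zero, zero_add] at hc1 hc2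
    exact ⟨(mul_eq_zero.mp hc1).resolve_right ht₁, (mul_eq_zero.mp hc2).resolve_right ht₂⟩


end Summit.ResolutionOfSingularities.ResolutionOfSingularities.Theorems.RadicialJung.CleanModels.Lens5.PRankTwoAssembly

end
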